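import Mathlib.Topology.ContinuousMap.Bounded.Star
import Summits.QuantumFields.BalabanUV.T4Continuum.Support.NE9FutureProfileStep
import Summits.QuantumFields.BalabanUV.T4Continuum.Support.NE9SliceSpaceOfRecord
import Summits.QuantumFields.BalabanUV.T4Continuum.Support.NE9TableReading

/-!
# NE9FutureProfileReal — ROUTE R4 «FADING BY EARLE–HAMILTON»: THE ORBIT OF THE FUTURE-INFLUENCE STEP IS REAL (self-adjoint)
# when the slice map is `star`-symmetrised, and the record's tables ∕ embedded families are self-adjoint vectors
# (cell `pub-balaban`, T4-DAG §6 NE9, route R4 of `t4/ROUTES-NE9.md` v4 §L1.0, recipe amendment (δ) = owner decision (D3);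
# OWNER `b2b-balaban-t4-ne9-p1` gen 60's word, CLAIMS.log l.28484 items (ii) + (iii) «file (iii) as a small `Support/NE9FutureProfileReal.lean`»;
# unit `b2b-balaban-t4-ne9-formalise-leaf-02` gen 31; imports (R4-3) PART 1 `NE9FutureProfileStep` p252939, the owner's
# `NE9SliceSpaceOfRecord` p252784 and `NE9TableReading` BY NAME; modifies nothing)

HONEST FRAMING (T4-DAG PAGE 1).  Rung (B)+1 of the FINITE-VOLUME T⁴ programme — NOT infinite volume, NOT a mass gap, NOT the
Clay problem.  NE9 (`T4OutputRate.NE9` ∧ `FadingMemory`) is a cell NEW ESTIMATE, NOT PRINTED in [I] = [Balaban1987RG1] (CMP 109),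
[II] = [Balaban1988RG2Cluster] (CMP 116), and NOT PROVED for Bałaban's E^{(j)} («NE9 ⇐ the named binders»; spine PROVED 0∕9; row NE9
WALLED ON A MODEL, O-NE9-1).  HONEST DEPENDENCY (cell line, verbatim): continuum YM on T⁴ ⇐ BetaPertH ∧ nine spine estimates (0/9
proved); BetaPertH ⇐ (D1) ∧ (D4) ∧ CAP+tail; G-an2-4 gates asym, D1 and NE2/3/4.  `FlowStep.BetaPertH`, (B), (B^μ) do not occur.
This file is `star`-ALGEBRA on the generic future-influence step: it constructs NO object of Bałaban's and discharges NO Bałaban-side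
hypothesis; nothing printed is asserted (ABSOLUTE RULE); no `def`, no `def … : Prop`; 0 sorry.

WHY THIS LEAF (route R4, item (δ) of F-ne9leaf02g30-1 ∕ ROUTES-NE9 v4 E42–E43 ∕ owner (D3) l.28192).  The record's new-term map is a
REAL PART (`NE9EndApplied.ΨOf … := (newTerm …).re − (newTerm … U₀ …).re + explZ`), while route R4 composes HOLOMORPHIC self-maps of
a complex state space `𝔜 × Fut W Pot` (`NE9FutureProfileStep.step ∕ emb`).  The cure adopted by the owner is to instantiate the
step's slice-map slot with the `star`-SYMMETRISED complex slice map `Φ^sym Q := 2⁻¹ • (Φ₀ Q + star (Φ₀ (star Q)))` (holomorphic,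
same bound — `Literature.Analysis.Complex.SymmetryPrincipleBanachStar`), which agrees with `Re Φ₀` EXACTLY at self-adjoint («real»)
tables.  For `hfac` against the record one must therefore know that EVERY ACTUAL STATE OF THE ORBIT IS SELF-ADJOINT.  THIS FILE
proves that, by induction along `emb`, from three `star`-facts: the slice map sends self-adjoint tables to self-adjoint slices
(automatic for `Φ^sym`, §3), the injections `J k` send (the relevant) self-adjoint slices to self-adjoint profiles (a DISPLAYED
hypothesis — the owner's ambient readings `RdAmb` are Hahn–Banach extensions and need not commute with `star`; the variant
`isSelfAdjoint_emb_of_class` asks it only on a class `Sl k` containing the orbit's slices, where the owner's `RdAmb = RdOf` does),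
and the initial state is self-adjoint; plus (ii) the record's vectors — `NE9TableReading.reading ∕ readingρ` (weight-divided real
tables) and `NE9SliceSpaceOfRecord.embR` (decay-weighted real families) — ARE self-adjoint in `lp (… → ℂ) ∞`.
* §1 self-adjointness plumbing [folklore]: `isSelfAdjoint_lp_iff` (⇔ real coordinates), `isSelfAdjoint_lp_of_ofReal`,
  `ofReal_re_apply_of_isSelfAdjoint`, `lp_symmetrise_apply` (`(2⁻¹ • (f + star f)) i = re (f i)`), `isSelfAdjoint_bcf_iff`,
  `isSelfAdjoint_prod_iff`, `ofReal_re_eq_of_star_comm` (a `star`-real functional is real on self-adjoint vectors — the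
  END's `.re` read-out (B4) loses nothing), `isSelfAdjoint_ofReal_smul`.
* §2 (ii): `isSelfAdjoint_reading`, `isSelfAdjoint_readingρ`, `isSelfAdjoint_embR`.
* §3 the symmetrised slot is `star`-EQUIVARIANT by pure algebra: `symmetrise_star`, `isSelfAdjoint_symmetrise`,
  `symmetrise_of_isSelfAdjoint` (`= 2⁻¹ • (Φ₀ Q + star (Φ₀ Q))`).
* §4 (iii) THE REAL ORBIT: `star_shift`, `isSelfAdjoint_step`, **`isSelfAdjoint_emb_of_class`** (J-hypothesis on a class only),
  `isSelfAdjoint_emb` (J-hypothesis on all self-adjoint slices), `isSelfAdjoint_emb_of_star_comm` (from full commutation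
  `Φ k s (star Q) = star (Φ k s Q)`, `J k (star y) = star (J k y)`), `isSelfAdjoint_snd_apply` ∕ `isSelfAdjoint_fst` (tables and
  slice of a self-adjoint state), `isSelfAdjoint_injRead` (∕ `_of_star_comm`: the injection FROM READINGS of (R4-3) §6 preserves
  self-adjointness when its readings do on the slice at hand — the owner's `RdAmb = RdOf` case).
* §5 THE SYMMETRISED INSTANCE: `isSelfAdjoint_emb_symmetrise`, **`newSlice_symmetrise_eq`** (along the orbit the new slice is
  `2⁻¹ • (Φ₀ Q + star (Φ₀ Q))` at the orbit's — self-adjoint — table `Q`), and for `𝔜 = lp (fun _ : κ => ℂ) ∞`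
  **`newSlice_symmetrise_apply`**: its coordinates are `((Φ₀ Q k).re : ℂ)` — the record's `.re`, with NO reality clause on `Φ₀`.
* §T non-vacuity (`𝔜 = Pot = ℂ`, a slice map with a genuinely complex part: the orbit is real all the same).
DISGUISE TEST: generic `star`-algebra on a product of a slice space and a bounded-function space; not NE9, not (R-0), not W1.

References (TYPES ∕ loci only): [Balaban1987RG1] T. Bałaban, CMP **109** (1987), (2.13)–(2.14) p. 268 (the new term is a real
part), (1.18) p. 263; [Balaban1988RG2Cluster] T. Bałaban, CMP **116** (1988), (1.36) p. 9 (weighted tables); L. V. Ahlfors,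
*Complex Analysis* (1979) Ch. 4 §6.5 p. 172 (symmetry principle) [AhlforsCA1979].  Summits-side NEW work (LEAN PLACEMENT RULE).
-/

noncomputable section

namespace Summit.QuantumFields.BalabanUV.T4Continuum.NE9FutureProfileReal

open ComplexConjugate Metric Set
open scoped ENNReal
open Literature.MathematicalPhysics.QuantumFieldTheory.Balaban1983to89.T4OutputRate
open Summit.QuantumFields.BalabanUV.T4Continuum.NE9FutureProfileStep

/-! ## §1 Self-adjointness plumbing: sequence spaces, bounded functions, products, real scalars -/

section Plumbing

variable {ι : Type*}

/-- A vector of `lp (fun _ : ι => ℂ) ∞` is SELF-ADJOINT (`star f = f`, `star` = coordinatewise conjugation) iff all its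
coordinates are real. [folklore] -/
theorem isSelfAdjoint_lp_iff (f : lp (fun _ : ι => ℂ) ∞) : IsSelfAdjoint f ↔ ∀ i, conj (f i) = f i := by
  refine ⟨fun h i => ?_, fun h => lp.ext (funext fun i => ?_)⟩
  · have := congrArg (fun g : lp (fun _ : ι => ℂ) ∞ => g i) h.star_eq
    simpa only [lp.star_apply, Complex.star_def] using this
  · rw [lp.star_apply, Complex.star_def, h i]

/-- A vector whose coordinates are casts of reals is self-adjoint. [folklore] -/
theorem isSelfAdjoint_lp_of_ofReal (f : lp (fun _ : ι => ℂ) ∞) (P : ι → ℝ) (hf : ∀ i, f i = (P i : ℂ)) :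
    IsSelfAdjoint f :=
  (isSelfAdjoint_lp_iff f).2 fun i => by rw [hf i, Complex.conj_ofReal]

/-- A self-adjoint vector has real coordinates: `((f i).re : ℂ) = f i`. [folklore] -/
theorem ofReal_re_apply_of_isSelfAdjoint {f : lp (fun _ : ι => ℂ) ∞} (hf : IsSelfAdjoint f) (i : ι) :
    ((f i).re : ℂ) = f i :=
  Complex.conj_eq_iff_re.mp ((isSelfAdjoint_lp_iff f).1 hf i)

/-- `2⁻¹ • (f + star f)` is the coordinatewise real part. [folklore] -/
theorem lp_symmetrise_apply (f : lp (fun _ : ι => ℂ) ∞) (i : ι) :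
    ((2⁻¹ : ℂ) • (f + star f) : lp (fun _ : ι => ℂ) ∞) i = ((f i).re : ℂ) := by
  rw [lp.coeFn_smul, Pi.smul_apply, lp.coeFn_add, Pi.add_apply, lp.star_apply, Complex.star_def, Complex.add_conj,
    smul_eq_mul]
  push_cast
  ring

/-- A bounded function is self-adjoint iff all its values are. [folklore] -/
theorem isSelfAdjoint_bcf_iff {α β : Type*} [TopologicalSpace α] [NormedAddCommGroup β] [StarAddMonoid β]
    [NormedStarGroup β] (x : BoundedContinuousFunction α β) : IsSelfAdjoint x ↔ ∀ a, IsSelfAdjoint (x a) := by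
  refine ⟨fun h a => ?_, fun h => BoundedContinuousFunction.ext fun a => ?_⟩
  · have := congrArg (fun g : BoundedContinuousFunction α β => g a) h.star_eq
    rw [isSelfAdjoint_iff]
    simpa only [BoundedContinuousFunction.star_apply] using this
  · rw [BoundedContinuousFunction.star_apply, (h a).star_eq]

/-- A pair is self-adjoint iff both components are. [folklore] -/
theorem isSelfAdjoint_prod_iff {A B : Type*} [Star A] [Star B] (z : A × B) :
    IsSelfAdjoint z ↔ IsSelfAdjoint z.1 ∧ IsSelfAdjoint z.2 := by
  rw [isSelfAdjoint_iff, isSelfAdjoint_iff, isSelfAdjoint_iff, Prod.star_def, Prod.ext_iff]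

/-- A functional that intertwines `star` with complex conjugation takes REAL values on self-adjoint vectors:
`((ℓ y).re : ℂ) = ℓ y` — so a `.re` read-out of a self-adjoint slice (the END's (B4) `E g U X = (coord U X slice).re`) loses
nothing. [folklore] -/
theorem ofReal_re_eq_of_star_comm {A : Type*} [Star A] (ℓ : A → ℂ) (hℓ : ∀ y, conj (ℓ y) = ℓ (star y)) {y : A}
    (hy : IsSelfAdjoint y) : ((ℓ y).re : ℂ) = ℓ y :=
  Complex.conj_eq_iff_re.mp (by rw [hℓ, hy.star_eq])

/-- Real multiples of self-adjoint vectors are self-adjoint (the scalar fact `IsSelfAdjoint (r : ℂ)` is `Complex.conj_ofReal`;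
an identically-named copy lives in `Literature.MathematicalPhysics.QuantumLattice`, not imported here). [folklore] -/
theorem isSelfAdjoint_ofReal_smul {A : Type*} [AddCommGroup A] [Module ℂ A] [Star A] [StarModule ℂ A] (r : ℝ) {y : A}
    (hy : IsSelfAdjoint y) : IsSelfAdjoint ((r : ℂ) • y) :=
  (show IsSelfAdjoint (r : ℂ) from Complex.conj_ofReal r).smul hy

end Plumbing

/-! ## §2 (ii) The record's vectors are self-adjoint: weight-divided tables and decay-weighted embedded families -/

section Record

/-- **THE WEIGHTED READING OF A REAL TABLE IS SELF-ADJOINT** (`NE9TableReading.reading wt Q`: coordinates `Q y ∕ wt y` cast to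
`ℂ` when bounded, else the zero vector — both self-adjoint). [folklore] -/
theorem isSelfAdjoint_reading {ι : Type} (wt : ι → ℝ) (Q : ι → ℝ) : IsSelfAdjoint (NE9TableReading.reading wt Q) := by
  by_cases h : Memℓp (NE9TableReading.wfun wt Q) ∞
  · exact isSelfAdjoint_lp_of_ofReal _ (fun y => Q y / wt y) fun y => by
      rw [NE9TableReading.reading_coe_of_mem h, NE9TableReading.wfun_apply]
  · rw [NE9TableReading.reading_of_not_mem h]
    exact IsSelfAdjoint.zero _

/-- … hence so is every level of `readingρ wt` (the END's `ρ` of record). [folklore] -/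
theorem isSelfAdjoint_readingρ {ι : Type} (wt : ℕ → ι → ℝ) (k : ℕ) (Q : ι → ℝ) :
    IsSelfAdjoint (NE9TableReading.readingρ wt k Q) :=
  isSelfAdjoint_reading (wt k) Q

/-- **THE EMBEDDED REAL FAMILY IS SELF-ADJOINT** (`NE9SliceSpaceOfRecord.embR κ H`: coordinates `e^{κd(X)}·H U X` cast to `ℂ`
when bounded, else zero). [folklore] -/
theorem isSelfAdjoint_embR {C : Carriers} {Bg : Type} (κ : ℝ) (H : Bg → C.Dom → ℝ) :
    IsSelfAdjoint (NE9SliceSpaceOfRecord.embR (C := C) κ H) := by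
  unfold NE9SliceSpaceOfRecord.embR
  split_ifs with h
  · exact isSelfAdjoint_lp_of_ofReal _ (fun p => Real.exp (κ * C.d p.2) * H p.1 p.2) fun p => rfl
  · exact IsSelfAdjoint.zero _

end Record

/-! ## §3 The `star`-symmetrised slot is `star`-equivariant (pure algebra; holomorphy ∕ size live in the Literature file) -/

section Symmetrise

variable {𝔜 Pot : Type*} [AddCommGroup 𝔜] [Module ℂ 𝔜] [StarAddMonoid 𝔜] [StarModule ℂ 𝔜] [InvolutiveStar Pot]

/-- **`star (Φ^sym Q) = Φ^sym (star Q)`** for `Φ^sym Q := 2⁻¹ • (Φ₀ Q + star (Φ₀ (star Q)))` — no hypothesis on `Φ₀`. [folklore] -/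
theorem symmetrise_star (Φ₀ : Pot → 𝔜) (Q : Pot) :
    star ((2⁻¹ : ℂ) • (Φ₀ Q + star (Φ₀ (star Q)))) = (2⁻¹ : ℂ) • (Φ₀ (star Q) + star (Φ₀ (star (star Q)))) := by
  rw [star_smul, star_add, star_star, star_star, add_comm, star_inv₀, star_ofNat]

/-- Hence `Φ^sym` sends self-adjoint tables to self-adjoint slices. [folklore] -/
theorem isSelfAdjoint_symmetrise (Φ₀ : Pot → 𝔜) {Q : Pot} (hQ : IsSelfAdjoint Q) :
    IsSelfAdjoint ((2⁻¹ : ℂ) • (Φ₀ Q + star (Φ₀ (star Q)))) := by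
  rw [isSelfAdjoint_iff, symmetrise_star, star_star, hQ.star_eq]

omit [StarModule ℂ 𝔜] in
/-- … where its value is `2⁻¹ • (Φ₀ Q + star (Φ₀ Q))` (the «real part» of the naive complexification). [folklore] -/
theorem symmetrise_of_isSelfAdjoint (Φ₀ : Pot → 𝔜) {Q : Pot} (hQ : IsSelfAdjoint Q) :
    (2⁻¹ : ℂ) • (Φ₀ Q + star (Φ₀ (star Q))) = (2⁻¹ : ℂ) • (Φ₀ Q + star (Φ₀ Q)) := by
  rw [hQ.star_eq]

end Symmetrise

/-! ## §4 (iii) THE REAL ORBIT of `NE9FutureProfileStep.step ∕ emb` -/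

section Orbit

variable {𝔜 Pot : Type*} [NormedAddCommGroup 𝔜] [NormedSpace ℂ 𝔜] [StarAddMonoid 𝔜] [StarModule ℂ 𝔜]
  [NormedAddCommGroup Pot] [NormedSpace ℂ Pot] [StarAddMonoid Pot] [NormedStarGroup Pot] [StarModule ℂ Pot]
variable {W : Set (ℕ → ℝ)} {Φ : ℕ → ℝ → Pot → 𝔜} {J : ℕ → (𝔜 →L[ℂ] Fut W Pot)} {τ₀ ωh : ℝ}

omit [NormedSpace ℂ 𝔜] [StarAddMonoid 𝔜] [StarModule ℂ 𝔜] [StarModule ℂ Pot] in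
/-- The shift commutes with `star` (it re-indexes). [folklore] -/
theorem star_shift (x : Fut W Pot) : star (shift W x) = shift W (star x) := by
  ext i
  rw [BoundedContinuousFunction.star_apply, shift_apply, shift_apply, BoundedContinuousFunction.star_apply]

omit [NormedSpace ℂ 𝔜] [StarAddMonoid 𝔜] [StarModule ℂ 𝔜] [StarModule ℂ Pot] in
/-- … so it preserves self-adjointness. [folklore] -/
theorem isSelfAdjoint_shift {x : Fut W Pot} (hx : IsSelfAdjoint x) : IsSelfAdjoint (shift W x) := by
  rw [isSelfAdjoint_iff, star_shift, hx.star_eq]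

/-- **ONE STEP.**  If the slice map at `(k, g k)` sends the self-adjoint table `z.2 ⟨0, g⟩` to a self-adjoint slice `y` and
`J k y` is self-adjoint, then `step k g` sends the self-adjoint state `z` to a self-adjoint state. [folklore] -/
theorem isSelfAdjoint_step {k : ℕ} {g : ℕ → ℝ} {z : 𝔜 × Fut W Pot} (hz : IsSelfAdjoint z)
    (hΦ : ∀ hg : g ∈ W, IsSelfAdjoint (Φ k (g k) (z.2 ⟨0, ⟨g, hg⟩⟩)))
    (hJ : ∀ hg : g ∈ W, IsSelfAdjoint (J k (Φ k (g k) (z.2 ⟨0, ⟨g, hg⟩⟩)))) :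
    IsSelfAdjoint (step W Φ J τ₀ ωh k g z) := by
  by_cases hg : g ∈ W
  · rw [step_of_mem hg, isSelfAdjoint_prod_iff]
    exact ⟨isSelfAdjoint_ofReal_smul τ₀ (hΦ hg),
      (isSelfAdjoint_ofReal_smul ωh (isSelfAdjoint_shift ((isSelfAdjoint_prod_iff z).1 hz).2)).add (hJ hg)⟩
  · unfold step
    rw [dif_neg hg]
    exact IsSelfAdjoint.zero _

/-- **THE REAL ORBIT — `J`-HYPOTHESIS ON A CLASS ONLY.**  Suppose: for every `k` and `g ∈ W` the slice map `Φ k (g k)` sends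
every self-adjoint table to a self-adjoint slice lying in a class `Sl k ⊆ 𝔜`; the injection `J k` sends every self-adjoint
slice OF THAT CLASS to a self-adjoint profile; and the initial state `e₀` is self-adjoint.  Then every actual state `emb k g`
is self-adjoint (for `g ∉ W` the orbit is `0` from step 1 on). [folklore] -/
theorem isSelfAdjoint_emb_of_class (Sl : ℕ → Set 𝔜)
    (hΦ : ∀ k, ∀ g ∈ W, ∀ Q : Pot, IsSelfAdjoint Q → IsSelfAdjoint (Φ k (g k) Q) ∧ Φ k (g k) Q ∈ Sl k)
    (hJ : ∀ k, ∀ y ∈ Sl k, IsSelfAdjoint y → IsSelfAdjoint (J k y)) {e₀ : 𝔜 × Fut W Pot} (he₀ : IsSelfAdjoint e₀) :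
    ∀ (k : ℕ) (g : ℕ → ℝ), IsSelfAdjoint (emb W Φ J τ₀ ωh e₀ k g) := by
  intro k
  induction k with
  | zero => intro g; exact he₀
  | succ k ih =>
    intro g
    rw [emb_succ]
    have hz := ih g
    have htab : ∀ hg : g ∈ W, IsSelfAdjoint ((emb W Φ J τ₀ ωh e₀ k g).2 ⟨0, ⟨g, hg⟩⟩) := fun hg =>
      (isSelfAdjoint_bcf_iff _).1 ((isSelfAdjoint_prod_iff _).1 hz).2 _
    refine isSelfAdjoint_step hz (fun hg => (hΦ k g hg _ (htab hg)).1) fun hg => ?_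
    obtain ⟨hsa, hmem⟩ := hΦ k g hg _ (htab hg)
    exact hJ k _ hmem hsa

/-- **THE REAL ORBIT — `J`-HYPOTHESIS ON ALL SELF-ADJOINT SLICES** (the class `Sl k = univ`). [folklore] -/
theorem isSelfAdjoint_emb (hΦ : ∀ k, ∀ g ∈ W, ∀ Q : Pot, IsSelfAdjoint Q → IsSelfAdjoint (Φ k (g k) Q))
    (hJ : ∀ k (y : 𝔜), IsSelfAdjoint y → IsSelfAdjoint (J k y)) {e₀ : 𝔜 × Fut W Pot} (he₀ : IsSelfAdjoint e₀) :
    ∀ (k : ℕ) (g : ℕ → ℝ), IsSelfAdjoint (emb W Φ J τ₀ ωh e₀ k g) :=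
  isSelfAdjoint_emb_of_class (fun _ => univ) (fun k g hg Q hQ => ⟨hΦ k g hg Q hQ, mem_univ _⟩)
    (fun k y _ hy => hJ k y hy) he₀

/-- **THE REAL ORBIT FROM FULL `star`-COMMUTATION** (the shape of the scratch probe `emb_real_of_equivariant`, leaf-02 g30):
`Φ k s (star Q) = star (Φ k s Q)` and `J k (star y) = star (J k y)` for all arguments. [folklore] -/
theorem isSelfAdjoint_emb_of_star_comm (hΦ : ∀ k s (Q : Pot), Φ k s (star Q) = star (Φ k s Q))
    (hJ : ∀ k (y : 𝔜), J k (star y) = star (J k y)) {e₀ : 𝔜 × Fut W Pot} (he₀ : IsSelfAdjoint e₀) :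
    ∀ (k : ℕ) (g : ℕ → ℝ), IsSelfAdjoint (emb W Φ J τ₀ ωh e₀ k g) :=
  isSelfAdjoint_emb (fun k g _ Q hQ => by rw [isSelfAdjoint_iff, ← hΦ, hQ.star_eq])
    (fun k y hy => by rw [isSelfAdjoint_iff, ← hJ, hy.star_eq]) he₀

omit [NormedSpace ℂ 𝔜] [StarModule ℂ 𝔜] [StarModule ℂ Pot] in
/-- Every TABLE of a self-adjoint state is self-adjoint (a coordinate of the profile component). [folklore] -/
theorem isSelfAdjoint_snd_apply {z : 𝔜 × Fut W Pot} (hz : IsSelfAdjoint z) (i : Idx W) : IsSelfAdjoint (z.2 i) :=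
  (isSelfAdjoint_bcf_iff _).1 ((isSelfAdjoint_prod_iff _).1 hz).2 i

omit [NormedSpace ℂ 𝔜] [StarModule ℂ 𝔜] [StarModule ℂ Pot] in
/-- … and so is its SLICE component. [folklore] -/
theorem isSelfAdjoint_fst {z : 𝔜 × Fut W Pot} (hz : IsSelfAdjoint z) : IsSelfAdjoint z.1 :=
  ((isSelfAdjoint_prod_iff _).1 hz).1

omit [StarAddMonoid 𝔜] [StarModule ℂ 𝔜] in
/-- **THE INJECTION BUILT FROM READINGS PRESERVES SELF-ADJOINTNESS** when the readings it files do (`NE9FutureProfileStep.injRead`: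
`(J k y)(n, s) = ωh⁻ⁿ • Rd (k+1+n) (k+1) s y`, a REAL multiple): if every reading `Rd (k+1+n) (k+1) s y`, `s ∈ W`, of the slice
`y` is a self-adjoint table, so is the profile `injRead Rd … k y` — the form in which the `J`-hypothesis of
`isSelfAdjoint_emb_of_class` is met by readings that commute with `star` on the slices that occur. [folklore] -/
theorem isSelfAdjoint_injRead (Rd : ℕ → ℕ → (ℕ → ℝ) → (𝔜 →L[ℂ] Pot)) {τ₀ ω ωh : ℝ} (hτ₀ : 0 ≤ τ₀) (hω : 0 ≤ ω)
    (hωh : 0 < ωh) (hωωh : ω ≤ ωh) (hRd : ∀ (j n : ℕ), ∀ s ∈ W, ‖Rd (j + n) j s‖ ≤ τ₀ * ω ^ n) (k : ℕ) {y : 𝔜}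
    (hy : ∀ (n : ℕ), ∀ s ∈ W, IsSelfAdjoint (Rd (k + 1 + n) (k + 1) s y)) :
    IsSelfAdjoint (injRead Rd hτ₀ hω hωh hωωh hRd k y) := by
  refine (isSelfAdjoint_bcf_iff _).2 fun i => ?_
  rw [injRead_apply]
  exact ((show IsSelfAdjoint ((ωh⁻¹ : ℝ) : ℂ) from Complex.conj_ofReal _).pow _).smul (hy i.n i.s i.s.2)

omit [StarModule ℂ 𝔜] in
/-- … in particular when the readings COMMUTE WITH `star` (canonical complexifications of real-linear readings do). [folklore] -/
theorem isSelfAdjoint_injRead_of_star_comm (Rd : ℕ → ℕ → (ℕ → ℝ) → (𝔜 →L[ℂ] Pot)) {τ₀ ω ωh : ℝ} (hτ₀ : 0 ≤ τ₀)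
    (hω : 0 ≤ ω) (hωh : 0 < ωh) (hωωh : ω ≤ ωh) (hRd : ∀ (j n : ℕ), ∀ s ∈ W, ‖Rd (j + n) j s‖ ≤ τ₀ * ω ^ n) (k : ℕ)
    (hcomm : ∀ (m j : ℕ), ∀ s ∈ W, ∀ y : 𝔜, Rd m j s (star y) = star (Rd m j s y)) {y : 𝔜} (hy : IsSelfAdjoint y) :
    IsSelfAdjoint (injRead Rd hτ₀ hω hωh hωωh hRd k y) :=
  isSelfAdjoint_injRead Rd hτ₀ hω hωh hωωh hRd k fun n s hs => by
    rw [isSelfAdjoint_iff, ← hcomm _ _ s hs, hy.star_eq]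

end Orbit

/-! ## §5 THE SYMMETRISED INSTANCE: the orbit is real and its new slices are the «real parts» of the naive slice map -/

section SymmetrisedOrbit

variable {𝔜 Pot : Type*} [NormedAddCommGroup 𝔜] [NormedSpace ℂ 𝔜] [StarAddMonoid 𝔜] [StarModule ℂ 𝔜]
  [NormedAddCommGroup Pot] [NormedSpace ℂ Pot] [StarAddMonoid Pot] [NormedStarGroup Pot] [StarModule ℂ Pot]
variable {W : Set (ℕ → ℝ)} (Φ₀ : ℕ → ℝ → Pot → 𝔜) {J : ℕ → (𝔜 →L[ℂ] Fut W Pot)} {τ₀ ωh : ℝ}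

/-- **THE ORBIT OF THE SYMMETRISED STEP IS REAL** (the slot `Φ := fun k s Q => 2⁻¹ • (Φ₀ k s Q + star (Φ₀ k s (star Q)))`): only
the `J`-hypothesis on a class `Sl k` containing the symmetrised slices of self-adjoint tables, and a self-adjoint `e₀`, are
needed — NO hypothesis on `Φ₀`. [folklore] -/
theorem isSelfAdjoint_emb_symmetrise (Sl : ℕ → Set 𝔜)
    (hSl : ∀ k, ∀ g ∈ W, ∀ Q : Pot, IsSelfAdjoint Q → (2⁻¹ : ℂ) • (Φ₀ k (g k) Q + star (Φ₀ k (g k) (star Q))) ∈ Sl k)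
    (hJ : ∀ k, ∀ y ∈ Sl k, IsSelfAdjoint y → IsSelfAdjoint (J k y)) {e₀ : 𝔜 × Fut W Pot} (he₀ : IsSelfAdjoint e₀) :
    ∀ (k : ℕ) (g : ℕ → ℝ),
      IsSelfAdjoint (emb W (fun k s Q => (2⁻¹ : ℂ) • (Φ₀ k s Q + star (Φ₀ k s (star Q)))) J τ₀ ωh e₀ k g) :=
  isSelfAdjoint_emb_of_class Sl (fun k g hg Q hQ => ⟨isSelfAdjoint_symmetrise (Φ₀ k (g k)) hQ, hSl k g hg Q hQ⟩) hJ he₀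

/-- **ALONG THE ORBIT THE NEW SLICE IS `2⁻¹ • (Φ₀ Q + star (Φ₀ Q))` AT THE ORBIT's (self-adjoint) TABLE `Q`** — the symmetrised
slot never evaluates `Φ₀` off the actual table. [folklore] -/
theorem newSlice_symmetrise_eq (Sl : ℕ → Set 𝔜)
    (hSl : ∀ k, ∀ g ∈ W, ∀ Q : Pot, IsSelfAdjoint Q → (2⁻¹ : ℂ) • (Φ₀ k (g k) Q + star (Φ₀ k (g k) (star Q))) ∈ Sl k)
    (hJ : ∀ k, ∀ y ∈ Sl k, IsSelfAdjoint y → IsSelfAdjoint (J k y)) {e₀ : 𝔜 × Fut W Pot} (he₀ : IsSelfAdjoint e₀)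
    (j : ℕ) {g : ℕ → ℝ} (hg : g ∈ W) :
    newSlice W (fun k s Q => (2⁻¹ : ℂ) • (Φ₀ k s Q + star (Φ₀ k s (star Q)))) J τ₀ ωh e₀ j g hg =
      (2⁻¹ : ℂ) • (Φ₀ j (g j) ((emb W (fun k s Q => (2⁻¹ : ℂ) • (Φ₀ k s Q + star (Φ₀ k s (star Q)))) J τ₀ ωh e₀ j g).2
          ⟨0, ⟨g, hg⟩⟩) +
        star (Φ₀ j (g j) ((emb W (fun k s Q => (2⁻¹ : ℂ) • (Φ₀ k s Q + star (Φ₀ k s (star Q)))) J τ₀ ωh e₀ j g).2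
          ⟨0, ⟨g, hg⟩⟩))) := by
  have hQ := isSelfAdjoint_snd_apply (isSelfAdjoint_emb_symmetrise (τ₀ := τ₀) (ωh := ωh) Φ₀ Sl hSl hJ he₀ j g) ⟨0, ⟨g, hg⟩⟩
  unfold newSlice
  exact symmetrise_of_isSelfAdjoint (Φ₀ j (g j)) hQ

/-- **… AND FOR A SEQUENCE-SPACE 𝔜 ITS COORDINATES ARE `Re (Φ₀ Q k)`** (`𝔜 = lp (fun _ : κ => ℂ) ∞`, e.g. the owner's ambient
slice space `lp (Bg × C.Dom → ℂ) ∞` of `NE9SliceSpaceOfRecord`): the record's `.re` of the naive complexification at the actual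
table, with NO reality clause on `Φ₀`. [folklore] -/
theorem newSlice_symmetrise_apply {κ : Type*} (Ψ₀ : ℕ → ℝ → Pot → lp (fun _ : κ => ℂ) ∞)
    {J' : ℕ → (lp (fun _ : κ => ℂ) ∞ →L[ℂ] Fut W Pot)} (Sl : ℕ → Set (lp (fun _ : κ => ℂ) ∞))
    (hSl : ∀ k, ∀ g ∈ W, ∀ Q : Pot, IsSelfAdjoint Q → (2⁻¹ : ℂ) • (Ψ₀ k (g k) Q + star (Ψ₀ k (g k) (star Q))) ∈ Sl k)
    (hJ : ∀ k, ∀ y ∈ Sl k, IsSelfAdjoint y → IsSelfAdjoint (J' k y)) {e₀ : lp (fun _ : κ => ℂ) ∞ × Fut W Pot}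
    (he₀ : IsSelfAdjoint e₀) (j : ℕ) {g : ℕ → ℝ} (hg : g ∈ W) (k : κ) :
    (newSlice W (fun k s Q => (2⁻¹ : ℂ) • (Ψ₀ k s Q + star (Ψ₀ k s (star Q)))) J' τ₀ ωh e₀ j g hg :
        lp (fun _ : κ => ℂ) ∞) k =
      (((Ψ₀ j (g j) ((emb W (fun k s Q => (2⁻¹ : ℂ) • (Ψ₀ k s Q + star (Ψ₀ k s (star Q)))) J' τ₀ ωh e₀ j g).2
          ⟨0, ⟨g, hg⟩⟩) : lp (fun _ : κ => ℂ) ∞) k).re : ℂ) := by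
  rw [newSlice_symmetrise_eq Ψ₀ Sl hSl hJ he₀ j hg, lp_symmetrise_apply]

end SymmetrisedOrbit

/-! ## §T Non-vacuity: a slice map with a genuinely complex part; the symmetrised orbit is real all the same -/

/-- TOY (`𝔜 = Pot = ℂ`, `W = Window (1/8)`, `Φ₀ k s P := s + (i/4)·P + i` — NOT real on real tables —, `J k := 0`, `e₀ = 0`):
every state of the orbit of the SYMMETRISED step is self-adjoint (real), by `isSelfAdjoint_emb_symmetrise` with the trivial
class. [folklore] -/
example (τ₀ ωh : ℝ) (k : ℕ) (g : ℕ → ℝ) :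
    IsSelfAdjoint (emb (𝔜 := ℂ) (Pot := ℂ) (Window (1 / 8))
      (fun k s Q => (2⁻¹ : ℂ) • ((fun (_ : ℕ) (s : ℝ) (P : ℂ) => (s : ℂ) + Complex.I / 4 * P + Complex.I) k s Q +
        star ((fun (_ : ℕ) (s : ℝ) (P : ℂ) => (s : ℂ) + Complex.I / 4 * P + Complex.I) k s (star Q))))
      (fun _ => 0) τ₀ ωh 0 k g) :=
  isSelfAdjoint_emb_symmetrise (W := Window (1 / 8)) (J := fun _ => 0)
    (fun (_ : ℕ) (s : ℝ) (P : ℂ) => (s : ℂ) + Complex.I / 4 * P + Complex.I) (fun _ => univ)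
    (fun _ _ _ _ _ => mem_univ _) (fun _ _ _ _ => by rw [FunLike.coe_zero, Pi.zero_apply]; exact IsSelfAdjoint.zero _)
    (IsSelfAdjoint.zero _) k g

end Summit.QuantumFields.BalabanUV.T4Continuum.NE9FutureProfileReal

end
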